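import Literature.Analysis.FluidPDE.AxisymmetricEuler
import Literature.Analysis.FluidPDE.KNSSRegularityPlanar
import HarnessLib

/-!
# Zlatoš 2015: (at least) exponential growth of the vorticity gradient / Hessian for 2-D Euler on
# the TORUS — the printed boundary-free counterpart of Kiselev–Šverák's disc theorem (named facts)

A. Zlatoš, *Exponential growth of the vorticity gradient for the Euler equation on the torus*,
Adv. Math. **268** (2015) 396–403 = arXiv:1310.6128 [Zlatos2015] (held text
`paper:arxiv-1310.6128`, chunks p0002–p0003 opened).

Setting (§1, p0003): the torus `(2𝕋)² = [−1,1)²` ("we identify opposite sides of the square"),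
Euler in vorticity form `ω_t + u·∇ω = 0`, `u` from `ω` by the periodised Biot–Savart law; data odd
in `x₁` and `x₂` (preserved), `‖ω(t)‖_∞ = ‖ω₀‖_∞`; global regularity (Wolibner, Hölder); the
double-exponential upper bound `‖∇ω(t)‖_∞ ≤ e^{Ce^{Ct}}`.

Printed (**Theorem 1.1**, p0003): "(i) For any `α ∈ (0,1)` and `A < ∞`, there is
`ω₀ ∈ C^{1,α}((2𝕋)²)` with `‖ω₀‖_{L^∞} ≤ 1` and there is `T₀ ≥ 0` such that the solution of (1.1)
satisfies for all `T ≥ T₀`, `sup_{t ≤ T} ‖∇ω(t,·)‖_{L^∞([0, 2exp(−AT)]²)} ≥ e^{AT}`. (ii) For any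
`A < ∞`, there is `ω₀ ∈ C^∞((2𝕋)²)` with `‖ω₀‖_{L^∞} ≤ 1` and there is `T₀ ≥ 0` such that the
solution of (1.1) satisfies for all `T ≥ T₀`, `sup_{t ≤ T} ‖D²ω(t,·)‖_{L^∞([0, 2exp(−AT)]²)} ≥ e^{AT}`."
Remarks (ibid.): in (i) `ω₀` "can be smooth except at the origin, with `ω₀(r,φ) = r^{1+α} sin(2φ)`
near the origin … both `u, ω` are smooth except at the origin at all times"; "The boundary is
crucial in [KS] and the double-exponential growth is proved to occur on it as well"; "The best
infinite time result in the plane or on the torus (i.e., domains without a boundary) so far has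
been … super-linear growth … by Denisov [Den]" — so after this paper the printed state for the
BULK is: exponential (this theorem) proved, double-exponential OPEN (Kiselev–Šverák 2014 §5,
`KiselevSverakSmallScaleCreation.lean`).

## Why the cell wants it (ns-blowup D-0081 §A1 zone Z8, sheet `profile/lit2/ZONE-LIT-Z8.md` §3)

Zone Z8 asks what the Hou–Luo corner collapse keeps when the wall is replaced by a mirror plane.
The 2-D record is the cleanest printed instance of "what the wall buys": WITH a wall,
double-exponential small-scale creation for all times (`KiselevSverak2014_doubleExponentialGrowth`);
WITHOUT a wall, the same hyperbolic-point scenario (odd–odd symmetry on the torus) is proved to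
give only (at least) exponential growth — this file — and whether the double-exponential rate is
attainable in the bulk is open in print. The Z8 K-block cites the pair by name; nothing here is a
statement about 3-D Euler or Navier–Stokes.

## Contents and rendering

* `IsTwoPeriodic v` — `2`-periodicity in both coordinate directions of a field on `ℝ²` (functions on
  `(2𝕋)²` are rendered as `2`-periodic functions on `ℝ²`; the tree's whole-space classical-solution
  classes then apply verbatim, the pressure being periodic on the torus).
* `Zlatos2015_hessianExponentialGrowth` — NAMED FACT, Thm 1.1 **(ii)**: for every `A > 0` there
  are a classical (jointly `C^∞`) `2`-periodic Euler solution `(u, p)` on `ℝ² × [0, ∞)`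
  (`IsClassicalEulerSolutionOn (Ici 0) 0 u p`) with `|curl2 (u 0)| ≤ 1` and `T₀ ≥ 0` such that for
  all `T ≥ T₀`, `sup_{t ≤ T} sup_{x ∈ [0, 2e^{−AT}]²} ‖D²(curl2 (u t))(x)‖ ≥ e^{AT}`, written
  junk-free as "every `M < e^{AT}` is exceeded at some `(t, x)` with `t ∈ [0,T]`, `x` in the box"
  (`D² =` `iteratedFDeriv ℝ 2`; the choice of norm on the Hessian only changes constants, which
  the quantifier "for any `A`" absorbs — recorded, not hidden).
* `Zlatos2015_gradientExponentialGrowth` — NAMED FACT, Thm 1.1 **(i)**: for every `α ∈ (0,1)` and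
  `A > 0`, a `2`-periodic Euler solution of class `C¹` jointly (`IsClassicalEulerOnDomain (Ici 0) ⊤
  0 0 u p`, the tree's reading of non-smooth classical solutions) whose vorticity slices are
  `C^{1,α}` (`FunctionSpaces.MemContDiffHolder 1 α (curl2 (u t))`), `|curl2 (u 0)| ≤ 1`, with the
  same growth clause for `‖D(curl2 (u t))(x)‖`.
  Both are WEAKER than print only in quantifying `A > 0` (the printed "any `A < ∞`"; `A ≤ 0` is
  the trivial range) — net debt +2 (two printed statements of one theorem, one file).
* PROVED (small API): `IsTwoPeriodic.add_nat_mul` (periodicity under all shifts `2k eᵢ`, `k : ℕ`),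
  `Zlatos2015_hessianExponentialGrowth.exists_hessian_gt` (the `ε`-free reading at `M = e^{AT}/2`).

WHAT THIS IS NOT: not 3-D, not Navier–Stokes; two statements of one printed 2-D inviscid theorem
WITHOUT boundary, typed as named `Prop`s for the Z8 sheet's "bulk side".

## References

* A. Zlatoš, Adv. Math. 268 (2015) 396–403, doi:10.1016/j.aim.2014.08.012 = arXiv:1310.6128:
  abstract (p0002), §1 setting and Thm 1.1 (i)–(ii) with the remarks after it (p0003).
  [`Zlatos2015`]
* A. Kiselev, V. Šverák, Ann. of Math. 180 (2014) (the disc theorem; Lemma 2.1 of this paper is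
  a sharpened version of their key lemma). [`KiselevSverak2014`]
-/

noncomputable section

open MeasureTheory Set Function Filter TopologicalSpace
open _root_.Topology
open scoped ContDiff NNReal

namespace Literature.Analysis.FluidPDE

/-! ### Periodicity -/

/-- A field on `ℝ²` is **`2`-periodic in both coordinate directions**: `v (x + 2eᵢ) = v x` for
`i = 0, 1` — the rendering of a function on the torus `(2𝕋)² = [−1,1)²` of Zlatoš's setting.
[cite: Zlatos2015, §1 ("Let (2𝕋)² = [−1,1)² be the two-dimensional torus", arXiv:1310.6128 p0003)] -/
def IsTwoPeriodic {F : Sort*} (v : EuclideanSpace ℝ (Fin 2) → F) : Prop :=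
  ∀ (x : EuclideanSpace ℝ (Fin 2)) (i : Fin 2), v (x + (2 : ℝ) • EuclideanSpace.single i 1) = v x

/-- A `2`-periodic field is invariant under the shifts `x ↦ x + 2k eᵢ`, `k : ℕ` (iterate the
definition). [cite: Zlatos2015, §1 (periodic extension of ω, arXiv:1310.6128 p0003)] -/
theorem IsTwoPeriodic.add_nat_mul {F : Sort*} {v : EuclideanSpace ℝ (Fin 2) → F}
    (h : IsTwoPeriodic v) (x : EuclideanSpace ℝ (Fin 2)) (i : Fin 2) (k : ℕ) :
    v (x + ((2 : ℝ) * k) • EuclideanSpace.single i 1) = v x := by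
  induction k with
  | zero => simp
  | succ k ih =>
    have : x + ((2 : ℝ) * (k + 1 : ℕ)) • EuclideanSpace.single i (1 : ℝ) =
        (x + ((2 : ℝ) * k) • EuclideanSpace.single i 1) + (2 : ℝ) • EuclideanSpace.single i 1 := by
      rw [Nat.cast_succ, mul_add, mul_one, add_smul, add_assoc]
    rw [this, h, ih]

/-! ### The named facts -/

/-- **Zlatoš 2015, Theorem 1.1 (ii)** (exponential growth of the vorticity HESSIAN for smooth
solutions of 2-D Euler on the torus). Printed: "For any `A < ∞`, there is `ω₀ ∈ C^∞((2𝕋)²)` with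
`‖ω₀‖_{L^∞} ≤ 1` and there is `T₀ ≥ 0` such that the solution of (1.1) satisfies for all `T ≥ T₀`,
`sup_{t ≤ T} ‖D²ω(t,·)‖_{L^∞([0, 2exp(−AT)]²)} ≥ e^{AT}`." **Rendering** (module docstring): for
every `A > 0` there are a jointly smooth classical solution `(u, p)` of the Euler equations
(`f = 0`) on `ℝ² × [0, ∞)`, `2`-periodic in both directions (a smooth solution on `(2𝕋)²`), with
`|curl2 (u 0)| ≤ 1` everywhere, and `T₀ ≥ 0`, such that for every `T ≥ T₀` and every
`M < e^{AT}` some `t ∈ [0, T]` and some `x ∈ [0, 2e^{−AT}]²` have `‖D²(curl2 (u t))(x)‖ > M`.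
[cite: Zlatos2015, Theorem 1.1 (ii) (arXiv:1310.6128 p0003)] -/
def Zlatos2015_hessianExponentialGrowth : Prop :=
  ∀ A : ℝ, 0 < A →
    ∃ (u : ℝ → EuclideanSpace ℝ (Fin 2) → EuclideanSpace ℝ (Fin 2))
      (p : ℝ → EuclideanSpace ℝ (Fin 2) → ℝ) (T₀ : ℝ),
      0 ≤ T₀ ∧ FluidPDE.IsClassicalEulerSolutionOn (Ici 0) 0 u p ∧
      (∀ t ∈ Ici (0 : ℝ), IsTwoPeriodic (u t) ∧ IsTwoPeriodic (p t)) ∧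
      (∀ x, |curl2 (u 0) x| ≤ 1) ∧
      ∀ T : ℝ, T₀ ≤ T → ∀ M : ℝ, M < Real.exp (A * T) →
        ∃ t ∈ Icc 0 T, ∃ x : EuclideanSpace ℝ (Fin 2),
          (∀ i : Fin 2, x i ∈ Icc (0 : ℝ) (2 * Real.exp (-(A * T)))) ∧
          M < ‖iteratedFDeriv ℝ 2 (curl2 (u t)) x‖

/-- **Zlatoš 2015, Theorem 1.1 (i)** (exponential growth of the vorticity GRADIENT for
`C^{1,α}`-vorticity solutions of 2-D Euler on the torus). Printed: "For any `α ∈ (0,1)` and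
`A < ∞`, there is `ω₀ ∈ C^{1,α}((2𝕋)²)` with `‖ω₀‖_{L^∞} ≤ 1` and there is `T₀ ≥ 0` such that the
solution of (1.1) satisfies for all `T ≥ T₀`, `sup_{t ≤ T} ‖∇ω(t,·)‖_{L^∞([0, 2exp(−AT)]²)} ≥ e^{AT}`"
(the datum "can be smooth except at the origin, with `ω₀(r,φ) = r^{1+α} sin(2φ)` near the origin";
"ω remains in `C^{1,α}`"). **Rendering**: for every `α ∈ (0,1)` and `A > 0` there are a classical
Euler solution `(u, p)` on `ℝ² × [0, ∞)` of class `C¹` jointly (`IsClassicalEulerOnDomain (Ici 0) ⊤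
0 0 u p`), `2`-periodic, whose vorticity slices `curl2 (u t)` are of class `C^{1,α}`
(`FunctionSpaces.MemContDiffHolder 1 α`), with `|curl2 (u 0)| ≤ 1`, and `T₀ ≥ 0`, such that for
every `T ≥ T₀` and `M < e^{AT}` some `t ∈ [0,T]`, `x ∈ [0, 2e^{−AT}]²` have `‖D(curl2 (u t))(x)‖ > M`.
[cite: Zlatos2015, Theorem 1.1 (i) and the remark after it (arXiv:1310.6128 p0003)] -/
def Zlatos2015_gradientExponentialGrowth : Prop :=
  ∀ (α : ℝ≥0), 0 < α → α < 1 → ∀ A : ℝ, 0 < A →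
    ∃ (u : ℝ → EuclideanSpace ℝ (Fin 2) → EuclideanSpace ℝ (Fin 2))
      (p : ℝ → EuclideanSpace ℝ (Fin 2) → ℝ) (T₀ : ℝ),
      0 ≤ T₀ ∧
      FluidPDE.IsClassicalEulerOnDomain (Ici 0) (⊤ : Opens (EuclideanSpace ℝ (Fin 2))) 0 0 u p ∧
      (∀ t ∈ Ici (0 : ℝ), IsTwoPeriodic (u t) ∧ IsTwoPeriodic (p t) ∧
        FunctionSpaces.MemContDiffHolder 1 α (curl2 (u t))) ∧
      (∀ x, |curl2 (u 0) x| ≤ 1) ∧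
      ∀ T : ℝ, T₀ ≤ T → ∀ M : ℝ, M < Real.exp (A * T) →
        ∃ t ∈ Icc 0 T, ∃ x : EuclideanSpace ℝ (Fin 2),
          (∀ i : Fin 2, x i ∈ Icc (0 : ℝ) (2 * Real.exp (-(A * T)))) ∧
          M < ‖fderiv ℝ (curl2 (u t)) x‖

/-! ### Proved reading -/

/-- Under Thm 1.1 (ii): for every rate `A > 0` Zlatoš's smooth periodic solution has, for all
large `T`, a time `t ≤ T` and a point of the shrinking box `[0, 2e^{−AT}]²` where the vorticity
Hessian exceeds `e^{AT}/2` — the `ε`-free form a sheet cites («at least exponential growth, in the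
bulk, for smooth data»). [cite: Zlatos2015, Theorem 1.1 (ii) (arXiv:1310.6128 p0003)] -/
theorem Zlatos2015_hessianExponentialGrowth.exists_hessian_gt
    (h : Zlatos2015_hessianExponentialGrowth) {A : ℝ} (hA : 0 < A) :
    ∃ (u : ℝ → EuclideanSpace ℝ (Fin 2) → EuclideanSpace ℝ (Fin 2)) (T₀ : ℝ), 0 ≤ T₀ ∧
      (∀ x, |curl2 (u 0) x| ≤ 1) ∧
      ∀ T : ℝ, T₀ ≤ T → ∃ t ∈ Icc 0 T, ∃ x : EuclideanSpace ℝ (Fin 2),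
        (∀ i : Fin 2, x i ∈ Icc (0 : ℝ) (2 * Real.exp (-(A * T)))) ∧
        Real.exp (A * T) / 2 < ‖iteratedFDeriv ℝ 2 (curl2 (u t)) x‖ := by
  obtain ⟨u, p, T₀, hT₀, -, -, hω, hgrow⟩ := h A hA
  refine ⟨u, T₀, hT₀, hω, fun T hT => ?_⟩
  exact hgrow T hT _ (half_lt_self (Real.exp_pos _))

end Literature.Analysis.FluidPDE

end
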